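import Summits.QuantumFields.BalabanUV.T4Continuum.Support.NE7PairChartDataGeneric
import Summits.QuantumFields.BalabanUV.T4Continuum.Support.NE7PairResidualSupRep
import HarnessLib

/-!
# NE7PairResidualSupRepGeneric — PORT MAP P2.5b: THE PAIR RESIDUAL SUP-REPRESENTATIVE AT ANY BLOCK SIZE `L ≥ 2` (F323b `NE7PairResidualSupRep.pair_residual_sup_rep`, `L = 2`,
# RE-ISSUED with `M = L^{k+1}`): two unitary `(N·M)`-periodic configurations `U′`, `U_s` with plaquettes `η`-close to `1` and THE SAME `(k+1)`-fold `L`-block average are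
# GAUGE-CLOSE IN SUP NORM in a RESIDUAL gauge — a unitary `(N·M)`-periodic site gauge `u`, trivial at every block corner `M•z`, with `‖U_s(b)⁻¹(U′^{u})(b) − 1‖ ≤ 10³⁴·M·η` on EVERY
# bond — as soon as `10²¹·L⁶·card n·M²η ≤ 1`

Cell `pub-balaban`, rung (B)+1 sub-cell t4, lineage `b2b-balaban-t4-ne7-p1`, generation 109 (CRUX PROVER NE7 #1 = OWNER of BINDER row NE7).  Memo
`t4/b2b-balaban-t4-ne7-p1-g109/ROAD-G109.md` §3 (PORT MAP item P2.5b).  ROAD (gen 94's, single top scale, no propagators; every step already `M`-generic in the tree): chart data (P2.5a) →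
gluing over the 16 parities of the BLOCK INDEX with the doubled period `2NM` (`NE7PairColourGlue.colour_glue`) → four period halvings (`NE7PairResidualSupRep.symmetrise_all`).
WHAT ([folklore]; 0 def, 0 sorry).  **`pair_residual_sup_rep_generic`**.
HONEST FRAMING (page 1): a theorem about ARBITRARY pairs of small-field lattice gauge fields with equal top averages; nothing of Bałaban's asserted; NE7 NOT proved; spine 0∕9; finite T⁴ rung
(B)+1 — NOT infinite volume, NOT mass gap, NOT BetaPertH, NOT Clay (continuum YM on T⁴ ⇐ BetaPertH ∧ nine spine estimates).
-/

set_option autoImplicit false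

open scoped BigOperators Matrix Matrix.Norms.L2Operator
open Finset NormedSpace

namespace Summit.QuantumFields.BalabanUV.T4Continuum.NE7PairResidualSupRepGeneric

open Literature.MathematicalPhysics.QuantumFieldTheory.Balaban1983to89
open B7Prop1Explicit B7Prop2Explicit
open T4AveragingDeficitWall (IsUnitaryCfg SmallField)
open T4AveragingDeficitWallBoundary (IsPeriodicCfg)
open AveragingDeficitMultiLevelPrep (cavgIter)
open NE3EnergyShapes (IsUnitarySite IsPeriodicSite)
open NE7PairChartDataGeneric (exists_pair_chart_data_generic)
open NE7PairColourGlue (colour_glue)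
open NE7PairResidualSupRep (symmetrise_all)
open NE7PairProfilesSharp (exists_coreProfile_sharp exists_parityBlock_sharp)

noncomputable section

variable {n : Type} [Fintype n] [DecidableEq n] [Nonempty n]

set_option maxHeartbeats 800000 in
/-- **THE PAIR RESIDUAL SUP-REPRESENTATIVE, ANY `L ≥ 2`** (statement in the file header; F323b generic). [folklore] -/
theorem pair_residual_sup_rep_generic {L : ℕ} (hL : 2 ≤ L) {U' Us : Site 4 → Fin 4 → (Matrix n n ℂ)ˣ} (hU' : IsUnitaryCfg U') (hUs : IsUnitaryCfg Us) {k N : ℕ} (hN : 1 ≤ N)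
    (hU'P : IsPeriodicCfg U' ((N * L ^ (k + 1) : ℕ) : ℤ)) (hUsP : IsPeriodicCfg Us ((N * L ^ (k + 1) : ℕ) : ℤ)) {η : ℝ} (hη : 0 < η)
    (hS' : SmallField U' η) (hSs : SmallField Us η) (htop : cavgIter L (k + 1) U' = cavgIter L (k + 1) Us)
    (hθ : 1000000000000000000000 * (L : ℝ) ^ 6 * (Fintype.card n : ℝ) * (((L : ℝ) ^ (k + 1)) ^ 2 * η) ≤ 1) :
    ∃ u : Site 4 → (Matrix n n ℂ)ˣ, IsUnitarySite u ∧ IsPeriodicSite u ((N * L ^ (k + 1) : ℕ) : ℤ) ∧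
      (∀ z : Site 4, u (((L ^ (k + 1) : ℕ) : ℤ) • z) = 1) ∧
      ∀ (x : Site 4) (μ : Fin 4), ‖(((Us x μ)⁻¹ * gaugeAct u U' x μ : (Matrix n n ℂ)ˣ) : Matrix n n ℂ) - 1‖
        ≤ 10000000000000000000000000000000000 * (L : ℝ) ^ (k + 1) * η := by
  letI : CStarAlgebra (Matrix n n ℂ) := {}
  have hL0 : (0 : ℝ) < L := by exact_mod_cast (show 0 < L by omega)
  have hL2r : (2 : ℝ) ≤ L := by exact_mod_cast hL
  have hL6 : (1 : ℝ) ≤ (L : ℝ) ^ 6 := one_le_pow₀ (by linarith)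
  set M : ℕ := L ^ (k + 1) with hMdef
  have hM2 : 2 ≤ M := by
    rw [hMdef]
    calc 2 ≤ L := hL
      _ = L ^ 1 := (pow_one L).symm
      _ ≤ L ^ (k + 1) := Nat.pow_le_pow_right (by omega) (by omega)
  have hM1 : 1 ≤ M := le_trans (by norm_num) hM2
  have hMr : (M : ℝ) = (L : ℝ) ^ (k + 1) := by rw [hMdef]; push_cast; ring
  have hM0 : (0 : ℝ) < M := by exact_mod_cast (by omega : 0 < M)
  have hM2r : (2 : ℝ) ≤ M := by exact_mod_cast hM2
  set θ : ℝ := (M : ℝ) ^ 2 * η with hθdef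
  have hθ0 : 0 ≤ θ := by positivity
  have hcard : (1 : ℝ) ≤ Fintype.card n := by exact_mod_cast Fintype.card_pos
  have hθL : 1000000000000000000000 * (L : ℝ) ^ 6 * (Fintype.card n : ℝ) * θ ≤ 1 := by rw [hθdef, hMr]; exact hθ
  have hθ' : 1000000000000000000000 * (Fintype.card n : ℝ) * θ ≤ 1 := by
    have : (Fintype.card n : ℝ) * θ ≤ (L : ℝ) ^ 6 * ((Fintype.card n : ℝ) * θ) := le_mul_of_one_le_left (by positivity) hL6
    nlinarith
  have hθ1 : 1000000000000000000000 * θ ≤ 1 := by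
    have : θ ≤ (Fintype.card n : ℝ) * θ := le_mul_of_one_le_left hθ0 hcard
    nlinarith
  -- §1 chart data
  have hθc : 1000000000000 * (L : ℝ) ^ 6 * (Fintype.card n : ℝ) * (((L : ℝ) ^ (k + 1)) ^ 2 * η) ≤ 1 := by
    rw [← hMr, ← hθdef]
    have : 0 ≤ (L : ℝ) ^ 6 * (Fintype.card n : ℝ) * θ := by positivity
    nlinarith
  obtain ⟨g, hgU, hpin, herr, hgeq, hτcc⟩ := exists_pair_chart_data_generic hL hU' hUs hU'P hUsP hη hS' hSs htop hθc
  rw [← hMr] at herr hτcc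
  -- §2 profiles and parity blocks
  obtain ⟨φ, hφ01, hφcore, hφsupp, hφlip, hφcov⟩ := exists_coreProfile_sharp (d := 4) hM1
  have hZ : ∀ c : Fin 4 → Fin 2, ∃ Z : Site 4 → Site 4,
      (∀ x, ∃ w : Site 4, Z x = (fun i => ((c i : ℕ) : ℤ)) + (2 : ℤ) • w) ∧
      (∀ x i, |x i - (M : ℤ) * Z x i| ≤ (M : ℤ)) ∧
      (∀ (x ζ w : Site 4), ζ = (fun i => ((c i : ℕ) : ℤ)) + (2 : ℤ) • w →
        (∀ i, -(M : ℤ) ≤ x i - (M : ℤ) * ζ i ∧ x i - (M : ℤ) * ζ i < (M : ℤ)) → Z x = ζ) ∧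
      (∀ (x : Site 4) (i : Fin 4), Z (x + ((2 * N * M : ℕ) : ℤ) • e i) = Z x + ((2 * N : ℕ) : ℤ) • e i) := by
    intro c
    obtain ⟨Z, h1, h2, h3, h4⟩ := exists_parityBlock_sharp (d := 4) hM1 (fun i => ((c i : ℕ) : ℤ))
    exact ⟨Z, h1, h2, h3, fun x i => h4 x i N⟩
  -- §3 the gluing over the 16 parities
  set τcc : ℝ := 4358144 * θ with hτcc_def
  set ηch : ℝ := 262144 * (M : ℝ) * η with hηch_def
  have hηch0 : 0 ≤ ηch := by positivity
  set T : ℝ := (4 ^ (2 ^ 4) - 1) / 3 * τcc with hT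
  have hTle : T ≤ 10000000000000000 * θ := by
    rw [hT, hτcc_def]; norm_num; nlinarith
  have hT0 : 0 ≤ T := by rw [hT]; positivity
  have hsmall : (4 ^ (2 ^ 4) - 1) / 3 * τcc ≤ 1 / 4 := by
    show T ≤ 1 / 4
    nlinarith
  obtain ⟨u₀, hu₀U, hu₀pin, hu₀per, hu₀site, hu₀bond⟩ :=
    colour_glue (d := 4) hUs hU' hM2 hgU hpin hηch0 herr hgeq (by positivity : (0 : ℝ) ≤ τcc) hτcc hsmall hφ01 hφcore hφsupp hφlip hφcov hZ
  -- §4 the four halvings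
  set E : ℝ := (6 ^ (2 ^ 4) - 1) / 5 * (7 * ηch + 16 * ((4 ^ (2 ^ 4) - 1) / 3 * τcc) / (M : ℝ)) with hE
  have hE0 : 0 ≤ E := by rw [hE]; positivity
  have h5832 : 5832 * T ≤ 1 := by nlinarith
  obtain ⟨u, huU, hupin, -, huhalf, -, hubond⟩ :=
    symmetrise_all hU' hUs hM1 hN hU'P hUsP hgeq hT0 hE0 h5832 hu₀U hu₀pin hu₀per hu₀site hu₀bond 4 le_rfl
  -- §5 the final constant: `13⁴·(E + 64T/M) ≤ 10³⁴·Mη`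
  have hMη : θ / (M : ℝ) = (M : ℝ) * η := by rw [hθdef]; field_simp
  have hEle : E ≤ 100000000000000000000000000000 * ((M : ℝ) * η) := by
    have h616 : ((6 : ℝ) ^ (2 ^ 4) - 1) / 5 ≤ 600000000000 := by norm_num
    have hin : 7 * ηch + 16 * ((4 ^ (2 ^ 4) - 1) / 3 * τcc) / (M : ℝ) ≤ 160000002000000000 * ((M : ℝ) * η) := by
      have h1 : 16 * ((4 ^ (2 ^ 4) - 1) / 3 * τcc) / (M : ℝ) ≤ 160000000000000000 * ((M : ℝ) * η) := by
        rw [← hT, ← hMη]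
        have := div_le_div_of_nonneg_right (mul_le_mul_of_nonneg_left hTle (by norm_num : (0 : ℝ) ≤ 16)) hM0.le
        calc 16 * T / (M : ℝ) ≤ 16 * (10000000000000000 * θ) / (M : ℝ) := this
          _ = 160000000000000000 * (θ / (M : ℝ)) := by ring
      have h2 : 7 * ηch ≤ 2000000 * ((M : ℝ) * η) := by rw [hηch_def]; nlinarith [mul_pos hM0 hη]
      linarith
    have hin0 : 0 ≤ 7 * ηch + 16 * ((4 ^ (2 ^ 4) - 1) / 3 * τcc) / (M : ℝ) := by positivity
    calc E = ((6 : ℝ) ^ (2 ^ 4) - 1) / 5 * (7 * ηch + 16 * ((4 ^ (2 ^ 4) - 1) / 3 * τcc) / (M : ℝ)) := hE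
      _ ≤ 600000000000 * (160000002000000000 * ((M : ℝ) * η)) := mul_le_mul h616 hin hin0 (by norm_num)
      _ ≤ _ := by nlinarith [mul_pos hM0 hη]
  have hfinal : (13 : ℝ) ^ 4 * (E + 16 * (4 : ℕ) * T / (M : ℝ)) ≤ 10000000000000000000000000000000000 * (L : ℝ) ^ (k + 1) * η := by
    rw [← hMr]
    have h1 : 16 * ((4 : ℕ) : ℝ) * T / (M : ℝ) ≤ 640000000000000000 * ((M : ℝ) * η) := by
      rw [← hMη]
      have := div_le_div_of_nonneg_right (mul_le_mul_of_nonneg_left hTle (by norm_num : (0 : ℝ) ≤ 64)) hM0.le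
      calc 16 * ((4 : ℕ) : ℝ) * T / (M : ℝ) = 64 * T / (M : ℝ) := by push_cast; ring
        _ ≤ 64 * (10000000000000000 * θ) / (M : ℝ) := this
        _ = 640000000000000000 * (θ / (M : ℝ)) := by ring
    have h13 : (13 : ℝ) ^ 4 = 28561 := by norm_num
    rw [h13]
    nlinarith [mul_pos hM0 hη]
  refine ⟨u, huU, fun x j => huhalf x j j.isLt, hupin, fun x μ => (hubond x μ).trans ?_⟩
  exact hfinal

end

end Summit.QuantumFields.BalabanUV.T4Continuum.NE7PairResidualSupRepGeneric
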